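import Summits.HodgeConjecture.CorCM.DihedralSexticPairCurvePowersTransfer
import HarnessLib

/-!
# COR-CM — TWO non-isomorphic sextic CM fields sharing an imaginary quadratic field: frame transfer for
# `E × B₁ × B₂` and all its powers (two frames, one 14-point model)

Cell `pub-hodgecm2` (COR-CM = stage 2 of the Hodge ladder), seat b30 gen 16 (2026-08-21); COUNT-NEUTRAL (no row of
`HOME/BINDER-OWNERS.md`); theorems only apart from two bookkeeping definitions (the slot map `slots` and the model map
`toPt₂`); no named fact, no `sorry`.

WHAT.  Gens 14/15 of this seat proved the Hodge conjecture, modulo Markman's fourfold theorem, for every product of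
copies of `E`, `B₀`, `B₁` — `E` a CM elliptic curve of the imaginary quadratic field `k`, `B₀`, `B₁` simple non-isogenous
CM threefolds of ONE non-Galois sextic CM field `K = k·F₀` — by reading the `Aut(ℂ)`-balanced weights (Pohlmann) of the
product in a finite 14-point model `Pt'` (`Census/DihedralSexticPairCurve.lean`, `Census/DihedralSexticPairCurvePowers.lean`)
through ONE frame `e : Hom(K, ℂ) ≃ ℤ/3 × Bool`.  This file is the first of the series TWO-FIELD-PAIR, which does the same
for TWO threefolds `B₁ ⊨ (K₁; Φ₁)`, `B₂ ⊨ (K₂; Φ₂)` with CM by two DIFFERENT sextic fields `K₁ = Kf (tl 0)`,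
`K₂ = Kf (tl 1)`, both containing `k = Kf i₀` (`i m : k → K_m`), read through TWO frames
`e m : Hom(K_m, ℂ) ≃ ℤ/3 × Bool` (`m = 0, 1`).  The model is the SAME 14-point model; what changes is the model map

  `toPt₂ e τ : (0, σ) ↦ inl [σ = τ]`, `(m+1, s) ↦ inr (m, e m s)`,

and the Galois hypothesis, which becomes JOINT: each of the six sign-preserving moves `(p, b) ↦ (±p + j, b)` is
realised by ONE automorphism of `ℂ` on `Hom(K₁, ℂ)` (through `e 0`) AND on `Hom(K₂, ℂ)` (through `e 1`) at the same time
(`he_gal`; derived from `K₁ ≇ K₂` in `CorCM/TwoSexticFieldsJointFrame.lean`).  The same-field setting of gens 14/15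
(`DihedralSexticPairCurve.curveSlots i₀ i₁`, one frame) is the definitional special case `tl = fun _ => i₁`,
`e = fun _ => e`.

* §0 `slots i₀ tl = (i₀, tl 0, tl 1)` (`Fin.cons`) and the model map `toPt₂`; `toPt₂_injective`.
* §1 FRAME TRANSFER: `exists_ringEquiv_realises₂` (all twelve elements of `S₃ × C₂` are realised jointly, the sign flips
  by composing with complex conjugation), `comp_mem_iff_act'_mem_phi'₂` (membership in the types is read in the model),
  **`modelBalanced_of_isGaloisBalancedAlg₂`** — for EVERY slot map `κ : Fin N → Fin 3`, an `Aut(ℂ)`-balanced weight of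
  `⨁_j A₃ (κ j)` (Pohlmann's condition `IsGaloisBalancedAlg` for the CM algebra `∏_j K_{κ j}`) is a balanced
  configuration of the 14-point model under `v = toPt₂ ∘ Sigma.map κ id` [cite: GaoUllmo2025, Thm 3.1 (3.2)]
  [cite: Pohlmann1968, Thm 1];
* §2 `toPt₂_conj_smul`, **`weightClassesAlg_le_algebraicClasses_of_image_eq_conjPair₂`** — a weight of `E × B₁ × B₂`
  whose model image is a conjugate pair is a conjugate pair `{x, x̄}`, so its weight line is a divisor line, algebraic
  [cite: Gordon1999HodgeAVSurvey, 9.2.2].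
The `weil4` / `pair6` generators (modulo Markman) are in `CorCM/TwoSexticFieldsGenerators.lean`, the assembly for all
powers in `CorCM/TwoSexticFieldsPowersHodgeOfMarkman.lean`.

HONEST FRAMING.  No geometry beyond divisors here; nothing is asserted about `HC_CM`; wording of record untouched.

## References
* [GaoUllmo2025] Z. Gao, E. Ullmo, J. Inst. Math. Jussieu 25 (2025), Thm 3.1.  [Pohlmann1968] H. Pohlmann, Ann. of
  Math. 88 (1968), Thm 1.  [Gordon1999HodgeAVSurvey] B. B. Gordon, CRM Monogr. 10 (1999), §9.2, 9.2.2.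
* [Deligne1982HodgeCycles] P. Deligne (notes by J. S. Milne), LNM 900 (1982), §5 (c).
-/

noncomputable section

open CategoryTheory CategoryTheory.Limits NumberField

namespace Summit.HodgeConjecture.CorCM.TwoSexticFields

open Literature.AlgebraicGeometry Literature.AlgebraicGeometry.Motives Literature.AlgebraicGeometry.HodgeTheory
open Literature.AlgebraicGeometry.ComplexMultiplication (IsCMTypeRealisation)
open Literature.AlgebraicGeometry.Pohlmann1968
open Literature.AlgebraicTopology.SingularHomology
open Literature.NumberTheory.ComplexMultiplication
open Summit.HodgeConjecture.CorCM.Census.DihedralSexticPair (Pt act phi act_apply mem_phi_iff)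
open Summit.HodgeConjecture.CorCM.Census.DihedralSexticPairCurve (Pt' act' phi' conjPair act'_inl act'_inr mem_phi'_inl
  mem_phi'_inr mem_conjPair_iff isCMType_phi')
open Summit.HodgeConjecture.CorCM.Census.DihedralSexticPairCurvePowers (ModelBalanced)
open Summit.HodgeConjecture.CorCM.DihedralSexticPair (act_mk_apply)
open Summit.HodgeConjecture.CorCM.DihedralSexticPairCurve (comp_eq_iff_of_realises)
open Summit.HodgeConjecture.CorCM.DihedralSexticPairCurvePowers (ncard_sep_eq_card_filter)
open Summit.HodgeConjecture.CorCM.PairWeights (weightClassesAlg_le_algebraicClasses_of_conj_smul_mem)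

open scoped Classical Pointwise

/-! ## §0 The slot map and the model map -/

section Defs

variable {I : Type}

/-- The fields of the three slots of `E × B₁ × B₂`: `(i₀, tl 0, tl 1)` — `Fin.cons`, so that `slots i₀ tl (m+1)` is
DEFINITIONALLY `tl m`; the same-field slot map `DihedralSexticPairCurve.curveSlots i₀ i₁` is `slots i₀ (fun _ => i₁)`.
[folklore] -/
def slots (i₀ : I) (tl : Fin 2 → I) : Fin 3 → I := Fin.cons i₀ tl

variable {Kf : I → Type} [∀ i, Field (Kf i)] {i₀ : I} {tl : Fin 2 → I}

/-- **The model map with two frames** `Hom(k × K₁ × K₂, ℂ) → Pt'`: `(0, σ) ↦ inl [σ = τ]`, `(m+1, s) ↦ inr (m, e m s)`.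
[folklore] -/
def toPt₂ (e : ∀ m : Fin 2, (Kf (tl m) →+* ℂ) ≃ ZMod 3 × Bool) (τ : Kf i₀ →+* ℂ) :
    ((j : Fin 3) × (Kf (slots i₀ tl j) →+* ℂ)) → Pt' := fun x =>
  Fin.cases (motive := fun j => (Kf (slots i₀ tl j) →+* ℂ) → Pt')
    (fun σ => Sum.inl (decide (σ = τ))) (fun m s => Sum.inr (m, e m s)) x.1 x.2

/-- `toPt₂` on the curve slot. [folklore] -/
@[simp] theorem toPt₂_zero (e : ∀ m : Fin 2, (Kf (tl m) →+* ℂ) ≃ ZMod 3 × Bool) (τ : Kf i₀ →+* ℂ)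
    (σ : Kf i₀ →+* ℂ) : toPt₂ e τ ⟨0, σ⟩ = Sum.inl (decide (σ = τ)) := rfl

/-- `toPt₂` on the threefold slots. [folklore] -/
@[simp] theorem toPt₂_succ (e : ∀ m : Fin 2, (Kf (tl m) →+* ℂ) ≃ ZMod 3 × Bool) (τ : Kf i₀ →+* ℂ) (m : Fin 2)
    (s : Kf (tl m) →+* ℂ) : toPt₂ e τ ⟨m.succ, s⟩ = Sum.inr (m, e m s) := rfl

end Defs

/-! ## §1 Frame transfer with two frames -/

section Transfer

variable {I : Type} {Kf : I → Type} [∀ i, Field (Kf i)]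
  {i₀ : I} {tl : Fin 2 → I} {e : ∀ m : Fin 2, (Kf (tl m) →+* ℂ) ≃ ZMod 3 × Bool} {τ : Kf i₀ →+* ℂ}
  (hττ : ComplexEmbedding.conjugate τ ≠ τ) (hk : ∀ σ : Kf i₀ →+* ℂ, σ = τ ∨ σ = ComplexEmbedding.conjugate τ)

/-- Every point of the index set is `(0, σ)` or `(m+1, s)`. [folklore] -/
theorem sigma_cases₂ (x : (j : Fin 3) × (Kf (slots i₀ tl j) →+* ℂ)) :
    (∃ σ : Kf i₀ →+* ℂ, x = ⟨0, σ⟩) ∨ ∃ (m : Fin 2) (s : Kf (tl m) →+* ℂ), x = ⟨m.succ, s⟩ := by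
  obtain ⟨j, s⟩ := x
  refine Fin.cases ?_ (fun m => ?_) j s
  · exact fun σ => Or.inl ⟨σ, rfl⟩
  · exact fun s => Or.inr ⟨m, s, rfl⟩

include hττ hk in
/-- The model map is injective (`Hom(k, ℂ) = {τ, τ̄}`, and the slot is part of the model point). [folklore] -/
theorem toPt₂_injective : Function.Injective (toPt₂ (i₀ := i₀) (tl := tl) e τ) := by
  intro x y hxy
  rcases sigma_cases₂ x with ⟨σ, rfl⟩ | ⟨m, s, rfl⟩ <;> rcases sigma_cases₂ y with ⟨σ', rfl⟩ | ⟨m', s', rfl⟩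
  · rw [toPt₂_zero, toPt₂_zero, Sum.inl.injEq] at hxy
    rcases hk σ with rfl | rfl <;> rcases hk σ' with rfl | rfl
    · rfl
    · simp only [decide_true] at hxy; exact absurd (of_decide_eq_true hxy.symm) hττ
    · simp only [decide_true] at hxy; exact absurd (of_decide_eq_true hxy) hττ
    · rfl
  · exact absurd hxy (by rw [toPt₂_zero, toPt₂_succ]; exact Sum.inl_ne_inr)
  · exact absurd hxy (by rw [toPt₂_zero, toPt₂_succ]; exact Sum.inr_ne_inl)
  · rw [toPt₂_succ, toPt₂_succ, Sum.inr.injEq, Prod.mk.injEq] at hxy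
    obtain ⟨rfl, h2⟩ := hxy
    rw [(e m).injective h2]

variable {i : ∀ m : Fin 2, Kf i₀ →+* Kf (tl m)}
  (he_sign : ∀ (m : Fin 2) (s : Kf (tl m) →+* ℂ), s.comp (i m) = τ ↔ (e m s).2 = true)
  (he_conj : ∀ (m : Fin 2) (s : Kf (tl m) →+* ℂ), e m (ComplexEmbedding.conjugate s) = ((e m s).1, !(e m s).2))
  (he_gal : ∀ (j : ZMod 3) (f : Bool), ∃ σ : ℂ ≃+* ℂ, ∀ (m : Fin 2) (s : Kf (tl m) →+* ℂ),
    e m ((σ : ℂ →+* ℂ).comp s) = ((if f then -(e m s).1 else (e m s).1) + j, (e m s).2))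

include he_conj he_gal in
/-- **Every element of `S₃ × C₂` is realised JOINTLY on `Hom(K₁, ℂ) ⊔ Hom(K₂, ℂ)` by an automorphism of `ℂ`**: the
sign-preserving ones by `he_gal`, the others by composing with complex conjugation.
[cite: Gordon1999HodgeAVSurvey, §9.2 (proof)] -/
theorem exists_ringEquiv_realises₂ (j : ZMod 3) (f d : Bool) : ∃ ρ : ℂ ≃+* ℂ, ∀ (m : Fin 2) (s : Kf (tl m) →+* ℂ),
    e m ((ρ : ℂ →+* ℂ).comp s) =
      ((if f then -(e m s).1 else (e m s).1) + j, if d then (e m s).2 else !(e m s).2) := by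
  obtain ⟨σ, hσ⟩ := he_gal j f
  cases d with
  | true => exact ⟨σ, fun m s => by rw [hσ]; rfl⟩
  | false =>
    refine ⟨(starRingAut : ℂ ≃+* ℂ).trans σ, fun m s => ?_⟩
    have hc : (((starRingAut : ℂ ≃+* ℂ).trans σ : ℂ ≃+* ℂ) : ℂ →+* ℂ).comp s =
        (σ : ℂ →+* ℂ).comp (ComplexEmbedding.conjugate s) := RingHom.ext fun _ => rfl
    rw [hc, hσ, he_conj]
    rfl

variable {Φ₃ : ∀ j : Fin 3, CMType (Kf (slots i₀ tl j))}
  (hΨ : ∀ σ : Kf i₀ →+* ℂ, σ ∈ (Φ₃ 0).1 ↔ σ = τ)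
  (hΦ : ∀ (m : Fin 2) (s : Kf (tl m) →+* ℂ), s ∈ (Φ₃ m.succ).1 ↔ (e m s).2 = decide ((e m s).1.val = m.val))

include hττ hk he_sign hΨ hΦ in
/-- **Membership read in the model (two frames)**: for a joint realiser `ρ` of `(j, f, d)`,
`ρ ∘ x ∈ Φ₃ ↔ act' j f d (toPt₂ x) ∈ phi'` (on the curve slot `ρ` fixes `τ` iff `d`, read on an embedding of `K₁`
over `τ` — gen 14's `DihedralSexticPairCurve.comp_eq_iff_of_realises` for the frame `e 0`). [cite: GaoUllmo2025, Thm 3.1 (3.2)] -/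
theorem comp_mem_iff_act'_mem_phi'₂ {ρ : ℂ ≃+* ℂ} {j : ZMod 3} {f d : Bool}
    (hρ : ∀ (m : Fin 2) (s : Kf (tl m) →+* ℂ), e m ((ρ : ℂ →+* ℂ).comp s) =
      ((if f then -(e m s).1 else (e m s).1) + j, if d then (e m s).2 else !(e m s).2))
    (x : (j : Fin 3) × (Kf (slots i₀ tl j) →+* ℂ)) :
    (ρ : ℂ →+* ℂ).comp x.2 ∈ (Φ₃ x.1).1 ↔ act' j f d (toPt₂ e τ x) ∈ phi' := by
  rcases sigma_cases₂ x with ⟨σ, rfl⟩ | ⟨m, s, rfl⟩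
  · change (ρ : ℂ →+* ℂ).comp σ ∈ (Φ₃ 0).1 ↔ _
    rw [hΨ, toPt₂_zero, act'_inl, mem_phi'_inl,
      comp_eq_iff_of_realises (e := e 0) (i := i 0) hττ hk (he_sign 0) ρ (hρ 0) σ]
  · change (ρ : ℂ →+* ℂ).comp s ∈ (Φ₃ m.succ).1 ↔ _
    rw [hΦ, hρ, toPt₂_succ, act'_inr, mem_phi'_inr, act_mk_apply, mem_phi_iff]

include hττ hk he_sign he_conj he_gal hΨ hΦ in
/-- **FRAME TRANSFER WITH TWO FRAMES, FOR ALL POWERS**: for every slot map `κ : Fin N → Fin 3`, an `Aut(ℂ)`-balanced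
weight of `X = ⨁_j A₃ (κ j)` (Pohlmann's condition `IsGaloisBalancedAlg` for the CM algebra `∏_j K_{κ j}` with the types
`Φ₃ (κ j)`) is a balanced configuration of the 14-point model under `v = toPt₂ e τ ∘ Sigma.map κ id` (the twelve
elements of `S₃ × C₂` are realised jointly by automorphisms of `ℂ`). [cite: GaoUllmo2025, Thm 3.1 (3.2)]
[cite: Pohlmann1968, Thm 1] -/
theorem modelBalanced_of_isGaloisBalancedAlg₂ {N : ℕ} (κ : Fin N → Fin 3)
    {S : Finset ((j : Fin N) × (Kf (slots i₀ tl (κ j)) →+* ℂ))}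
    (hS : IsGaloisBalancedAlg (K := fun j => Kf (slots i₀ tl (κ j))) (fun j => Φ₃ (κ j)) S) :
    ModelBalanced (fun x => toPt₂ e τ ((Sigma.map κ (fun _ => id) :
      ((j : Fin N) × (Kf (slots i₀ tl (κ j)) →+* ℂ)) → ((m : Fin 3) × (Kf (slots i₀ tl m) →+* ℂ))) x)) S := by
  intro j f d
  obtain ⟨ρ, hρ⟩ := exists_ringEquiv_realises₂ he_conj he_gal j f d
  have h := hS ρ
  rw [ncard_sep_eq_card_filter, ncard_sep_eq_card_filter] at h
  have key : ∀ x : (j : Fin N) × (Kf (slots i₀ tl (κ j)) →+* ℂ),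
      (ρ : ℂ →+* ℂ).comp x.2 ∈ (Φ₃ (κ x.1)).1 ↔ act' j f d (toPt₂ e τ ((Sigma.map κ (fun _ => id) :
        ((j : Fin N) × (Kf (slots i₀ tl (κ j)) →+* ℂ)) → ((m : Fin 3) × (Kf (slots i₀ tl m) →+* ℂ))) x))
          ∈ phi' :=
    fun x => comp_mem_iff_act'_mem_phi'₂ hττ hk he_sign hΨ hΦ hρ ⟨κ x.1, x.2⟩
  rw [Finset.filter_congr fun x _ => key x, Finset.filter_congr fun x _ => (key x).not] at h
  exact h

include hττ hk he_sign he_conj he_gal hΨ hΦ in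
/-- The one-copy case: an `Aut(ℂ)`-balanced weight of `E × B₁ × B₂` itself is a balanced configuration under `toPt₂`.
[cite: GaoUllmo2025, Thm 3.1 (3.2)] -/
theorem modelBalanced_of_isGaloisBalancedAlg₂_self {S : Finset ((j : Fin 3) × (Kf (slots i₀ tl j) →+* ℂ))}
    (hS : IsGaloisBalancedAlg (K := fun j => Kf (slots i₀ tl j)) Φ₃ S) :
    ModelBalanced (toPt₂ e τ) S := by
  intro j f d
  obtain ⟨ρ, hρ⟩ := exists_ringEquiv_realises₂ he_conj he_gal j f d
  have h := hS ρ
  rw [ncard_sep_eq_card_filter, ncard_sep_eq_card_filter] at h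
  have key : ∀ x : (j : Fin 3) × (Kf (slots i₀ tl j) →+* ℂ),
      (ρ : ℂ →+* ℂ).comp x.2 ∈ (Φ₃ x.1).1 ↔ act' j f d (toPt₂ e τ x) ∈ phi' :=
    fun x => comp_mem_iff_act'_mem_phi'₂ hττ hk he_sign hΨ hΦ hρ x
  rw [Finset.filter_congr fun x _ => key x, Finset.filter_congr fun x _ => (key x).not] at h
  exact h

omit [∀ i, Field (Kf i)] in
/-- Complex conjugation on the curve slot of the index set. [folklore] -/
theorem conj_smul_zero₂ [∀ i, Field (Kf i)] (σ : Kf i₀ →+* ℂ) :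
    (starRingAut : ℂ ≃+* ℂ) • (⟨0, σ⟩ : (j : Fin 3) × (Kf (slots i₀ tl j) →+* ℂ)) =
      ⟨0, (ComplexEmbedding.conjugate σ : Kf i₀ →+* ℂ)⟩ :=
  Sigma.ext rfl (heq_of_eq (RingHom.ext fun _ => rfl))

omit [∀ i, Field (Kf i)] in
/-- Complex conjugation on the threefold slots of the index set. [folklore] -/
theorem conj_smul_succ₂ [∀ i, Field (Kf i)] (m : Fin 2) (s : Kf (tl m) →+* ℂ) :
    (starRingAut : ℂ ≃+* ℂ) • (⟨m.succ, s⟩ : (j : Fin 3) × (Kf (slots i₀ tl j) →+* ℂ)) =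
      ⟨m.succ, (ComplexEmbedding.conjugate s : Kf (tl m) →+* ℂ)⟩ :=
  Sigma.ext rfl (heq_of_eq (RingHom.ext fun _ => rfl))

include he_conj hττ hk in
/-- Conjugation is read in the model: `toPt₂ (x̄) = c · toPt₂ x`. [folklore] -/
theorem toPt₂_conj_smul (x : (j : Fin 3) × (Kf (slots i₀ tl j) →+* ℂ)) :
    toPt₂ e τ ((starRingAut : ℂ ≃+* ℂ) • x) = act' 0 false false (toPt₂ e τ x) := by
  rcases sigma_cases₂ x with ⟨σ, rfl⟩ | ⟨m, s, rfl⟩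
  · have key : decide (ComplexEmbedding.conjugate σ = τ) = !decide (σ = τ) := by
      rcases hk σ with rfl | rfl
      · rw [decide_eq_false hττ]; simp
      · rw [ComplexEmbedding.involutive_conjugate, decide_eq_false hττ]; simp
    rw [conj_smul_zero₂]
    show (Sum.inl (decide (ComplexEmbedding.conjugate σ = τ)) : Pt') =
      Sum.inl (if false then decide (σ = τ) else !decide (σ = τ))
    rw [key]
    simp
  · rw [conj_smul_succ₂]
    show (Sum.inr (m, e m (ComplexEmbedding.conjugate s)) : Pt') = Sum.inr (act 0 false false (m, e m s))
    rw [he_conj, act_mk_apply]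
    simp

end Transfer

/-! ## §2 The conjugate-pair generator -/

section ConjPair

variable {I : Type} {Kf : I → Type} [∀ i, Field (Kf i)] [∀ i, NumberField (Kf i)] [∀ i, IsCMField (Kf i)]
  {i₀ : I} {tl : Fin 2 → I} {e : ∀ m : Fin 2, (Kf (tl m) →+* ℂ) ≃ ZMod 3 × Bool} {τ : Kf i₀ →+* ℂ}
  (hττ : ComplexEmbedding.conjugate τ ≠ τ) (hk : ∀ σ : Kf i₀ →+* ℂ, σ = τ ∨ σ = ComplexEmbedding.conjugate τ)
  (he_conj : ∀ (m : Fin 2) (s : Kf (tl m) →+* ℂ), e m (ComplexEmbedding.conjugate s) = ((e m s).1, !(e m s).2))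
  {A₃ : Fin 3 → AbelianVariety ℂ} {Φ₃ : ∀ j : Fin 3, CMType (Kf (slots i₀ tl j))}
  {ι₃ : ∀ j, 𝓞 (Kf (slots i₀ tl j)) →+* End (A₃ j)}
  {θ₃ : ∀ j, Kf (slots i₀ tl j) →+* Module.End ℂ (complexBetti (A₃ j).X 1)}
  (hA : ∀ j, IsCMTypeRealisation (Φ₃ j) (A₃ j) (ι₃ j) (θ₃ j))

include hττ hk he_conj hA in
/-- **A weight of `E × B₁ × B₂` whose model image is a conjugate pair is a conjugate pair `{x, x̄}`** (the model map is
injective and intertwines complex conjugation with `c`), so its weight line is a divisor line, algebraic (Lefschetz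
`(1,1)` on an abelian variety: `PairWeights.weightClassesAlg_le_algebraicClasses_of_conj_smul_mem`).
[cite: Gordon1999HodgeAVSurvey, 9.2.2] -/
theorem weightClassesAlg_le_algebraicClasses_of_image_eq_conjPair₂
    {T : Finset ((j : Fin 3) × (Kf (slots i₀ tl j) →+* ℂ))} {y : Pt'} (hT : T.image (toPt₂ e τ) = conjPair y) :
    T.card = 2 ∧ weightClassesAlg A₃ ι₃ (2 * 1) T ≤ algebraicClasses (⨁ A₃).X 1 := by
  have hinj := toPt₂_injective (e := e) hττ hk (tl := tl)
  have hcard : T.card = 2 := by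
    rw [← Finset.card_image_of_injective T hinj, hT, conjPair, Finset.card_pair]
    exact fun h => (isCMType_phi'.2.2 y) h.symm
  refine ⟨hcard, weightClassesAlg_le_algebraicClasses_of_conj_smul_mem hA (m := 1) hcard fun x hx => ?_⟩
  have hx' : toPt₂ e τ x ∈ conjPair y := hT ▸ Finset.mem_image_of_mem _ hx
  have hcx : toPt₂ e τ ((starRingAut : ℂ ≃+* ℂ) • x) ∈ T.image (toPt₂ e τ) := by
    rw [toPt₂_conj_smul hττ hk he_conj x, hT, mem_conjPair_iff] at *
    rcases hx' with h | h
    · exact Or.inr (by rw [h])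
    · exact Or.inl (by rw [h, isCMType_phi'.2.1])
  exact (hinj.mem_finset_image).1 hcx

end ConjPair

end Summit.HodgeConjecture.CorCM.TwoSexticFields

end
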